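import Mathlib
import Literature.AlgebraicGeometry.Resolution.CutkoskyPointStepCharts
import Literature.AlgebraicGeometry.Resolution.CurveChartPresentation
import Literature.AlgebraicGeometry.Resolution.SymbolicPowersRsop
import HarnessLib

/-!
# Cutkosky 2009, proof of Thm. 10.18: a curve step of a `τ = 1` sequence along `V(z, x)`, read in good parameters, is a Tr3 chart (PROVED)

Topic: `Literature/AlgebraicGeometry/Resolution`.  S. D. Cutkosky, *Resolution of singularities for
3-folds in positive characteristic*, Amer. J. Math. **131** (2009) 59–127 [cite: Cutkosky2009],
proof of Theorem 10.18, p. 37 l. 1–6 ("If `Sing_r(I_n) = V(x_n, z_n)` then … `R_n → R_{n+1}` must be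
a Tr3 transformation by Lemma 5.1, since `V(z_n)` is an approximate manifold of `I_n`.  `R_{n+1}` has
regular parameters `x_{n+1}, y_{n+1}, z_{n+1}` defined by `x_n = x_{n+1}, y_n = y_{n+1},
z_n = x_{n+1} z_{n+1}`") and p. 36 l. 84–90 (the Tr4 case `Sing_r(I_n) = V(y_n, z_n)`, symmetric).

In the frame of `CutkoskySurfaceOmegaSequence.lean` (`k⟦x, y, z⟧`, `IsCurveStep I I' φ r P` = SOME
presentation `u ↦ (u'_0, u'_0 u'_1, u'_2)` with `P = (u 0, u 1)`, weak transform `I' = (I R' : u'_0^r)`):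
given good parameters `c = (z, x, y)` with `P = (z, x)` and `I ⊆ (z^r) + 𝔪^{r+1}`,

* `le_pow_of_inSingR_span_pair` — `P ∈ Sing_r(I)` for the nonsingular curve germ `P = (u 0, u 1)`
  means `I ⊆ P^r` (symbolic = ordinary powers, tree `mem_pow_span_image_rsop_of_mul_mem`);
* `exists_goodChart_of_isCurveStep` — **the Tr3 chart data**: regular parameters `c'` of the target
  with `c'_1 = φ(x)`, `φ(z) = φ(x) c'_0`, `c'_2 = φ(y)`, `I R' ⊆ (φ(x)^r)`, `I' = (I R' : φ(x)^r)`
  — exactly the hypotheses `(h₁, h₀, h₂, hJ'def)` of `CurveBlowupPolygonLaws` / `CurveStepPrepared`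
  / `CutkoskySurfaceOmegaCurveChart`.  (Lemma 5.1 (2) on the fiber — the centre is the point
  `z/x = 0` — is `CurveChartPresentation.colon_map_eq_top_of_monic_curve`; the change of
  presentation is `exists_curveChart_presentation`.)  The Tr4 case is the same theorem applied to
  the system `(z, y, x)`.

THAT the curve of `Sing_r(I_n)` through `q_n` IS `V(z_n, x_n)` or `V(z_n, y_n)` in the maintained
good parameters (Cutkosky: Lemmas 10.13–10.15, last clauses, via Lemma 5.1 (1)) is NOT proved here;
its algebraic half is `NearCurveExceptional.curve_eq_span_pair_of_inSingR`.

AI-written; weaker than expert review.  No definitions, no facts.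

## Sources

* S. D. Cutkosky, Amer. J. Math. 131 (2009), proof of Thm. 10.18 p. 36 l. 84 – p. 37 l. 6;
  Def. 10.10 p. 31 l. 46 – p. 32 l. 4; Lemma 5.1 (2) p. 17 l. 46–50. [Cutkosky2009]
* H. Matsumura, Commutative Ring Theory (1986), Thm. 16.2 (ii) (symbolic powers). [Matsumura1987]
-/

noncomputable section

open IsLocalRing

namespace Literature.AlgebraicGeometry.Resolution.Cutkosky2009

universe u

variable {k : Type u} [Field k]

/-- **`P ∈ Sing_r(I)` ⇒ `I ⊆ P^r`** for a nonsingular curve germ `P = (u 0, u 1)` of `k⟦x, y, z⟧`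
(the powers of `P` are `P`-primary). [cite: Matsumura1987, Thm. 16.2 (ii)]
[cite: Cutkosky2009, §5 p. 17 l. 13] -/
theorem le_pow_of_inSingR_span_pair {u : Fin 3 → MvPowerSeries (Fin 3) k} (hu : IsParams u)
    {I : Ideal (MvPowerSeries (Fin 3) k)} {r : ℕ} (h : InSingR I r (Ideal.span {u 0, u 1})) :
    I ≤ Ideal.span {u 0, u 1} ^ r := by
  classical
  haveI : IsRegularLocalRing (MvPowerSeries (Fin 3) k) := isRegularLocalRing_mvPowerSeries k (Fin 3)
  have hdim : ringKrullDim (MvPowerSeries (Fin 3) k) = 3 := by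
    rw [ringKrullDim_mvPowerSeries, Nat.card_eq_fintype_card, Fintype.card_fin]; rfl
  have hd : (maximalIdeal (MvPowerSeries (Fin 3) k)).spanFinrank = 3 := by
    have h := IsRegularLocalRing.spanFinrank_maximalIdeal (R := MvPowerSeries (Fin 3) k)
    rw [hdim] at h; exact_mod_cast h
  have hx : Ideal.span (Set.range u) = maximalIdeal (MvPowerSeries (Fin 3) k) :=
    span_range_eq_of_span_triple u hu
  have hS : Ideal.span (u '' ((({0, 1} : Finset (Fin 3)) : Set (Fin 3)))) = Ideal.span {u 0, u 1} := by
    congr 1; ext a; simp [eq_comm]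
  intro g hg
  obtain ⟨s, hs, hsg⟩ := h.2 g hg
  have := mem_pow_span_image_rsop_of_mul_mem hd u hx ({0, 1} : Finset (Fin 3)) (a := s)
    (by rw [hS]; exact hs) r (y := g) (by rw [hS]; exact hsg)
  rw [hS] at this
  exact this

/-- **Cutkosky 2009, proof of Thm. 10.18: «`R_n → R_{n+1}` must be a Tr3 transformation by Lemma
5.1, since `V(z_n)` is an approximate manifold of `I_n`», PROVED** in the frame of
`CutkoskySurfaceOmegaSequence.lean`: for a curve step `IsCurveStep I I' φ r P` (`r ≥ 1`) along a curve
`P ∈ Sing_r(I)`, ideals of order exactly `r`, good parameters `c = (z, x, y)` with `P = (z, x)` and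
`I ⊆ (z^r) + 𝔪^{r+1}`, there are regular parameters `c'` of the target with `c'_1 = φ(x)`,
`φ(z) = φ(x) c'_0`, `c'_2 = φ(y)`, `I R' ⊆ (φ(x)^r)` and `I' = (I R' : φ(x)^r)`.
[cite: Cutkosky2009, proof of Thm. 10.18, p. 37 l. 1–6; Def. 10.10 p. 31 l. 46 – p. 32 l. 4] -/
theorem exists_goodChart_of_isCurveStep {r : ℕ} (hr : 1 ≤ r)
    {I I' P : Ideal (MvPowerSeries (Fin 3) k)}
    {φ : MvPowerSeries (Fin 3) k →ₐ[k] MvPowerSeries (Fin 3) k}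
    (hst : IsCurveStep I I' φ r P) (hsing : InSingR I r P) (hI : HasOrder I r) (hI' : HasOrder I' r)
    {c : Fin 3 → MvPowerSeries (Fin 3) k} (hc : IsParams c) (hPc : P = Ideal.span {c 0, c 1})
    (hIz : I ≤ Ideal.span {c 0 ^ r} ⊔ maximalIdeal (MvPowerSeries (Fin 3) k) ^ (r + 1)) :
    ∃ c' : Fin 3 → MvPowerSeries (Fin 3) k,
      IsParams c' ∧ c' 1 = φ (c 1) ∧ φ (c 0) = φ (c 1) * c' 0 ∧ c' 2 = φ (c 2) ∧
      I.map φ ≤ Ideal.span {φ (c 1) ^ r} ∧ I' = (I.map φ).colon (Ideal.span {φ (c 1) ^ r}) := by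
  classical
  obtain ⟨u, u', hu, hu', hPu, h0, h1, h2, hmap, hI'def⟩ := hst
  have hu'i : ∀ i, u' i ∈ maximalIdeal (MvPowerSeries (Fin 3) k) := fun i => by
    rw [← show Ideal.span {u' 0, u' 1, u' 2} = _ from hu']
    exact Ideal.subset_span (by fin_cases i <;> simp)
  haveI : IsLocalHom (φ : MvPowerSeries (Fin 3) k →+* MvPowerSeries (Fin 3) k) := by
    refine isLocalHom_of_isPointStepData hu fun i => ?_
    fin_cases i
    · show φ (u 0) ∈ _; rw [h0]; exact hu'i 0
    · show φ (u 1) ∈ _; rw [h1]; exact Ideal.mul_mem_left _ _ (hu'i 1)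
    · show φ (u 2) ∈ _; rw [h2]; exact hu'i 2
  haveI : IsRegularLocalRing (MvPowerSeries (Fin 3) k) := isRegularLocalRing_mvPowerSeries k (Fin 3)
  have hdim : ringKrullDim (MvPowerSeries (Fin 3) k) = 3 := by
    rw [ringKrullDim_mvPowerSeries, Nat.card_eq_fintype_card, Fintype.card_fin]; rfl
  have hci : ∀ i, c i ∈ maximalIdeal (MvPowerSeries (Fin 3) k) := fun i => by
    rw [← show Ideal.span {c 0, c 1, c 2} = _ from hc]
    exact Ideal.subset_span (by fin_cases i <;> simp)
  have hP : Ideal.span {c 0, c 1} = Ideal.span {u 0, u 1} := hPc.symm.trans hPu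
  -- `z = α u₀ + β u₁`
  have hz' : c 0 ∈ Ideal.span ({u 0, u 1} : Set (MvPowerSeries (Fin 3) k)) := by
    rw [← hP]; exact Ideal.subset_span (by simp)
  obtain ⟨α, β, hz⟩ := Ideal.mem_span_pair.mp hz'
  -- `I ⊆ P^r`
  have hIP : I ≤ Ideal.span {u 0, u 1} ^ r := le_pow_of_inSingR_span_pair hu (hPu ▸ hsing)
  -- a monic element of `I`
  obtain ⟨g, hg, hgn⟩ : ∃ g ∈ I, g ∉ maximalIdeal (MvPowerSeries (Fin 3) k) ^ (r + 1) := by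
    by_contra h
    push Not at h
    exact hI.2 h
  obtain ⟨s, hs, h', hh', hgsum⟩ := Submodule.mem_sup.mp (hIz hg)
  obtain ⟨a, rfl⟩ := Ideal.mem_span_singleton'.mp hs
  have ha : IsUnit a := by
    by_contra hna
    apply hgn
    rw [← hgsum]
    refine Ideal.add_mem _ ?_ hh'
    rw [pow_succ']
    exact Ideal.mul_mem_mul ((mem_maximalIdeal _).mpr hna) (Ideal.pow_mem_pow (hci 0) r)
  have hrem : g - a * c 0 ^ r ∈ maximalIdeal (MvPowerSeries (Fin 3) k) ^ (r + 1) := by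
    rw [← hgsum, add_sub_cancel_left]; exact hh'
  -- the centre is a near point: `α ∈ 𝔪`
  have hα : α ∈ maximalIdeal (MvPowerSeries (Fin 3) k) := by
    by_contra hαu
    have hαU : IsUnit α := (notMem_maximalIdeal).mp hαu
    have htop := colon_map_eq_top_of_monic_curve
      (φ : MvPowerSeries (Fin 3) k →+* MvPowerSeries (Fin 3) k) hu' hdim h0 h1 hg (hIP hg) ha hrem
      hz hαU
    have hI'top : I' = ⊤ := by rw [hI'def]; exact htop
    have h1le : I' ≤ maximalIdeal (MvPowerSeries (Fin 3) k) :=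
      hI'.1.trans (Ideal.pow_le_self (by omega))
    rw [hI'top, top_le_iff] at h1le
    exact (maximalIdeal.isMaximal (MvPowerSeries (Fin 3) k)).ne_top h1le
  -- change of presentation
  obtain ⟨c', hc', hspan, h1', h0', h2'⟩ := exists_curveChart_presentation
    (φ : MvPowerSeries (Fin 3) k →+* MvPowerSeries (Fin 3) k) hc hdim hu hu' h0 h1 h2 hP hz hα
  have h1'' : c' 1 = φ (c 1) := h1'
  have hx : Ideal.span {φ (c 1) ^ r} = Ideal.span {u' 0 ^ r} := by
    rw [← Ideal.span_singleton_pow, ← Ideal.span_singleton_pow, ← h1'', hspan]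
  refine ⟨c', hc', h1'', by simpa using h0', by simpa using h2', ?_, ?_⟩
  · rw [hx]; exact hmap
  · rw [hx]; exact hI'def

end Literature.AlgebraicGeometry.Resolution.Cutkosky2009
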